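import Summits.Schanuel.Schanuel.Theorems.ZilberEacBranchAlgebraic
import Summits.Schanuel.Schanuel.Theorems.ZilberEacGraphLinearComplete
import Summits.Schanuel.Schanuel.Theorems.ZilberEacGraphSimpleTopRow
import Summits.Schanuel.Schanuel.Theorems.ZilberEacQuadraticLogTranscendence
import Summits.Schanuel.Schanuel.Theorems.ZilberEacGrowthDensity
import Mathlib.Analysis.Complex.Polynomial.Basic
import HarnessLib

/-!
# The equimodular class, XXXV: RECIPROCAL-TYPE quadratic fibres over polynomial graphs are dense —
# the residual of THEOREM EB in `y₀`-degree `2`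

HONEST FRAMING.  Cell `pub-schanuel` (Zilber's Exponential-Algebraic Closedness, case ladder;
host summit Schanuel), seat 2, gen 24.  **`unprojectedDense_graph_reciprocalQuadratic`**: let
`p ∈ ℂ[X]` have degree `≥ 2` and let `P(x₀, y₀) = q₂(x₀) y₀² + q₁(x₀) y₀ + c·q₂(x₀)` be irreducible
(rows of degree `≤ N`), with a SIMPLE nonzero root `θ` of the top row
`T = [x₀^N]q₂·X² + [x₀^N]q₁·X + c[x₀^N]q₂`, a root `a` of `q₂` (automatically not a root of `q₁`:
the rows of an irreducible `P` are coprime), and a root of odd multiplicity (e.g. a simple root) of the discriminant `D = q₁² - 4c q₂²`.  Then `{x₁ = p(x₀), P(x₀, y₀) = 0}` has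
Zariski-dense exponential points.  These are exactly the quadratic fibres where the all-branches trick
of THEOREM EB is void (`q_0 = c·q_2`: the product of the two branches is constant); instead, the
logarithm of ONE branch is shown transcendental over `ℂ(z)` (file XXXIV: the branch `ρ = ψ(1/z)`
of file XXIII satisfies `(log ρ)' = W S/(q₂ D)` with `S = 2q₂ρ + q₁`, `S² = D`, `W = q₁q₂' - q₂q₁'`),
which contradicts the algebraicity forced by non-density (file XXVII).  Example (file XXXVI):
`{x₁ = x₀³, x₀y₀² + y₀ + x₀ = 0}`.  Complete classes of instances of an OPEN question (Mantova–Masser,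
PLMS 2024 §1 p. 5); fibres of `y₀`-degree `≥ 3` with `q_0 = c q_r` and multiple top-row roots remain;
EC(3,2) OPEN; NOT Schanuel's conjecture (neither used nor implied; EAC ⇏ SC).
-/

noncomputable section

open Filter Topology Set Complex MvPolynomial
open Literature.NumberTheory.Transcendental Literature.ModelTheory.Zilber
open Literature.ModelTheory.ExponentialFields

set_option linter.dupNamespace false

namespace Summit.Schanuel.Schanuel.Theorems

/-- **The rows `q₂, q₁` of an irreducible reciprocal-type quadratic fibre are coprime** (a common
root `t` would split off the factor `x₀ - t`). [folklore] -/
theorem isCoprime_of_irreducible_reciprocalQuadratic {q₁ q₂ : Polynomial ℂ} (c : ℂ) (hq₂ : q₂ ≠ 0)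
    {P : MvPolynomial (Fin 2) ℂ}
    (hP : ∀ x y : ℂ, MvPolynomial.eval ![x, y] P = q₂.eval x * y ^ 2 + q₁.eval x * y + c * q₂.eval x)
    (hirr : Irreducible P) : IsCoprime q₂ q₁ := by
  classical
  have hPAB : P = Polynomial.aeval (X 0 : MvPolynomial (Fin 2) ℂ) q₂ * X 1 ^ 2 +
      Polynomial.aeval (X 0 : MvPolynomial (Fin 2) ℂ) q₁ * X 1 +
      MvPolynomial.C c * Polynomial.aeval (X 0 : MvPolynomial (Fin 2) ℂ) q₂ := by
    refine MvPolynomial.funext fun xs => ?_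
    have hxs : xs = ![xs 0, xs 1] := by
      funext i; fin_cases i <;> rfl
    rw [map_add, map_add, map_mul, map_mul, map_mul, map_pow, MvPolynomial.eval_X, MvPolynomial.eval_C,
      mvEval_aeval_X, mvEval_aeval_X]
    conv_lhs => rw [hxs, hP]
  rw [Polynomial.isCoprime_iff_aeval_ne_zero_of_isAlgClosed ℂ ℂ]
  intro t
  by_contra hboth
  push Not at hboth
  obtain ⟨hAt, hBt⟩ := hboth
  rw [Polynomial.coe_aeval_eq_eval] at hAt hBt
  obtain ⟨A₁, hA₁⟩ := (Polynomial.dvd_iff_isRoot.2 hAt : Polynomial.X - Polynomial.C t ∣ q₂)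
  obtain ⟨B₁, hB₁⟩ := (Polynomial.dvd_iff_isRoot.2 hBt : Polynomial.X - Polynomial.C t ∣ q₁)
  set L : MvPolynomial (Fin 2) ℂ := X 0 - MvPolynomial.C t with hL
  set Q : MvPolynomial (Fin 2) ℂ := Polynomial.aeval (X 0 : MvPolynomial (Fin 2) ℂ) A₁ * X 1 ^ 2 +
    Polynomial.aeval (X 0 : MvPolynomial (Fin 2) ℂ) B₁ * X 1 +
    MvPolynomial.C c * Polynomial.aeval (X 0 : MvPolynomial (Fin 2) ℂ) A₁ with hQ
  have hfac : P = L * Q := by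
    rw [hPAB, hA₁, hB₁, hQ, hL, map_mul, map_mul, map_sub, Polynomial.aeval_X, Polynomial.aeval_C,
      MvPolynomial.algebraMap_eq]
    ring
  have hA₁0 : A₁ ≠ 0 := by
    rintro rfl; rw [mul_zero] at hA₁; exact hq₂ hA₁
  have hLnu : ¬ IsUnit L := by
    intro hu
    have h := (hu.map (MvPolynomial.eval ![t, 0])).ne_zero
    apply h
    simp [hL]
  have hQnu : ¬ IsUnit Q := by
    intro hu
    obtain ⟨s, hs⟩ : ∃ s : ℂ, A₁.eval s ≠ 0 := by
      by_contra h
      push Not at h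
      exact hA₁0 (Polynomial.funext fun s => by simpa using h s)
    -- a root `y` of `A₁(s) y² + B₁(s) y + c A₁(s)`
    set q : Polynomial ℂ := Polynomial.C (A₁.eval s) * Polynomial.X ^ 2 + Polynomial.C (B₁.eval s) * Polynomial.X +
      Polynomial.C (c * A₁.eval s) with hq
    have hqdeg : 0 < q.degree := by rw [hq, Polynomial.degree_quadratic hs]; norm_num
    obtain ⟨y, hy⟩ := Complex.exists_root hqdeg
    have h := (hu.map (MvPolynomial.eval ![s, y])).ne_zero
    apply h
    rw [hQ, map_add, map_add, map_mul, map_mul, map_mul, map_pow, MvPolynomial.eval_X, MvPolynomial.eval_C,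
      mvEval_aeval_X, mvEval_aeval_X]
    simp only [Matrix.cons_val_zero, Matrix.cons_val_one]
    have := hy.eq_zero
    simp only [hq, Polynomial.eval_add, Polynomial.eval_mul, Polynomial.eval_C, Polynomial.eval_pow,
      Polynomial.eval_X] at this
    linear_combination this
  rcases hirr.isUnit_or_isUnit hfac with h | h
  · exact hLnu h
  · exact hQnu h

/-- **Reciprocal-type quadratic fibres over polynomial graphs of degree `≥ 2` are dense.**  See the
module docstring. [cite: MantovaMasser2023, §1 Further remarks, p. 5 (the question, open in general)]
(new) -/
theorem unprojectedDense_graph_reciprocalQuadratic (q₁ q₂ : Polynomial ℂ) (c : ℂ)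
    {P : MvPolynomial (Fin 2) ℂ}
    (hP : ∀ x y : ℂ, MvPolynomial.eval ![x, y] P = q₂.eval x * y ^ 2 + q₁.eval x * y + c * q₂.eval x)
    (hirr : Irreducible P) (N : ℕ) (hN₂ : q₂.natDegree ≤ N) (hN₁ : q₁.natDegree ≤ N)
    (T : Polynomial ℂ)
    (hTdef : T = Polynomial.C (q₂.coeff N) * Polynomial.X ^ 2 + Polynomial.C (q₁.coeff N) * Polynomial.X +
      Polynomial.C (c * q₂.coeff N))
    (hT0 : T ≠ 0) {θ : ℂ} (hθ0 : θ ≠ 0) (hTθ : T.IsRoot θ) (hT'θ : (Polynomial.derivative T).eval θ ≠ 0)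
    {a e : ℂ} (hq₂ : q₂ ≠ 0) (ha : q₂.IsRoot a)
    (hDodd : Odd (Polynomial.rootMultiplicity e (q₁ ^ 2 - Polynomial.C (4 * c) * q₂ ^ 2)))
    (p : Polynomial ℂ) (hd : 2 ≤ p.natDegree) :
    UnprojectedDense {w : Fin 2 ⊕ Fin 2 → ℂ | w (Sum.inl 1) = p.eval (w (Sum.inl 0)) ∧
      MvPolynomial.eval ![w (Sum.inl 0), w (Sum.inr 0)] P = 0} := by
  classical
  -- a root of `q₂` is not a root of `q₁` (irreducibility)
  have hq₁a : ¬ q₁.IsRoot a := by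
    intro hb
    obtain ⟨u, v, huv⟩ := isCoprime_of_irreducible_reciprocalQuadratic c hq₂ hP hirr
    have := congrArg (Polynomial.eval a) huv
    rw [Polynomial.eval_add, Polynomial.eval_mul, Polynomial.eval_mul, ha.eq_zero, hb.eq_zero, mul_zero,
      mul_zero, add_zero, Polynomial.eval_one] at this
    exact zero_ne_one this
  by_contra hnot
  -- the rows
  set Q : Polynomial (Polynomial ℂ) := Polynomial.C q₂ * Polynomial.X ^ 2 + Polynomial.C q₁ * Polynomial.X +
    Polynomial.C (Polynomial.C c * q₂) with hQ
  set D : Polynomial ℂ := q₁ ^ 2 - Polynomial.C (4 * c) * q₂ ^ 2 with hD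
  set W : Polynomial ℂ := q₁ * Polynomial.derivative q₂ - q₂ * Polynomial.derivative q₁ with hW
  have hPQ : ∀ x y : ℂ, MvPolynomial.eval ![x, y] P = (Q.map (Polynomial.evalRingHom x)).eval y := by
    intro x y
    rw [hP, hQ]
    simp only [Polynomial.map_add, Polynomial.map_mul, Polynomial.map_C, Polynomial.map_pow,
      Polynomial.map_X, Polynomial.coe_evalRingHom, Polynomial.eval_add, Polynomial.eval_mul,
      Polynomial.eval_C, Polynomial.eval_pow, Polynomial.eval_X]
  have hcoefQ : ∀ j, Q.coeff j = if j = 2 then q₂ else if j = 1 then q₁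
      else if j = 0 then Polynomial.C c * q₂ else 0 := by
    intro j
    simp only [hQ, Polynomial.coeff_add, Polynomial.coeff_C_mul, Polynomial.coeff_X_pow, Polynomial.coeff_X,
      Polynomial.coeff_C]
    rcases j with _ | _ | _ | j <;> simp
  have hN : ∀ j, (Q.coeff j).natDegree ≤ N := by
    intro j
    rw [hcoefQ]
    split_ifs
    · exact hN₂
    · exact hN₁
    · exact (Polynomial.natDegree_C_mul_le _ _).trans hN₂
    · simp
  have hT : ∀ j, T.coeff j = (Q.coeff j).coeff N := by
    intro j
    rw [hcoefQ, hTdef]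
    simp only [Polynomial.coeff_add, Polynomial.coeff_C_mul, Polynomial.coeff_X_pow, Polynomial.coeff_X,
      Polynomial.coeff_C]
    rcases j with _ | _ | _ | j <;> simp
  -- the branch and its algebraic logarithm (file XXVII)
  obtain ⟨ψ, δ, hδ, hψ0, hψan, hψball, hψroot, -, hψalg⟩ :=
    exists_algebraic_branchLog_of_not_dense Q hPQ hirr N hN T hT hT0 hθ0 hTθ hT'θ p hd hnot
  -- a large real point beyond the roots of `q₂ D`
  have hD0 : D ≠ 0 := by
    intro h; rw [h, Polynomial.rootMultiplicity_zero] at hDodd; exact (Nat.not_odd_zero hDodd).elim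
  obtain ⟨R₀, hR₀⟩ : ∃ R₀ : ℝ, ∀ z : ℂ, (q₂ * D).IsRoot z → ‖z‖ ≤ R₀ := by
    obtain ⟨C, hC⟩ := ((q₂ * D).roots.toFinset.finite_toSet.isBounded).exists_norm_le
    exact ⟨C, fun z hz => hC z (by
      simpa [Multiset.mem_toFinset, Polynomial.mem_roots (mul_ne_zero hq₂ hD0)] using hz)⟩
  set R : ℝ := max (max R₀ 0) δ⁻¹ with hRdef
  have hR0 : 0 ≤ R := (le_max_right R₀ 0).trans (le_max_left _ _)
  have hgoodz : ∀ z : ℂ, R < ‖z‖ → z ≠ 0 ∧ ‖z⁻¹‖ < δ ∧ q₂.eval z ≠ 0 ∧ D.eval z ≠ 0 := by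
    intro z hz
    have hzpos : 0 < ‖z‖ := lt_of_le_of_lt hR0 hz
    have hz0 : z ≠ 0 := norm_pos_iff.1 hzpos
    have hzu : ‖z⁻¹‖ < δ := by
      rw [norm_inv]
      calc ‖z‖⁻¹ < (δ⁻¹)⁻¹ := (inv_lt_inv₀ hzpos (by positivity)).2 (lt_of_le_of_lt (le_max_right _ _) hz)
        _ = δ := inv_inv δ
    have hqD : ¬ (q₂ * D).IsRoot z := fun h =>
      absurd (lt_of_le_of_lt ((le_max_left R₀ 0).trans (le_max_left _ _)) hz) (not_lt.2 (hR₀ z h))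
    rw [Polynomial.IsRoot, Polynomial.eval_mul, mul_eq_zero, not_or] at hqD
    exact ⟨hz0, hzu, hqD.1, hqD.2⟩
  set z₀ : ℂ := ((R + 1 : ℝ) : ℂ) with hz₀def
  have hz₀ : R < ‖z₀‖ := by
    rw [hz₀def, Complex.norm_real, Real.norm_eq_abs, abs_of_pos (by linarith)]; linarith
  have hz₀δ : δ⁻¹ < ‖z₀‖ := lt_of_le_of_lt (le_max_right _ _) hz₀
  obtain ⟨hLan, hLalg⟩ := hψalg z₀ hz₀δ
  obtain ⟨H, hH0, hH⟩ := exists_polyPoly_relation hLalg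
  have hnear : ∀ᶠ y in 𝓝 z₀, R < ‖y‖ :=
    (continuous_norm.continuousAt (x := z₀)).eventually (lt_mem_nhds hz₀)
  -- the branch `ρ`, the square root `S = 2q₂ρ + q₁`
  set ρ : ℂ → ℂ := fun z => ψ z⁻¹ with hρ
  have hρfacts : ∀ z : ℂ, R < ‖z‖ → AnalyticAt ℂ ρ z ∧ ρ z ≠ 0 ∧ ρ z / θ ∈ Complex.slitPlane ∧
      q₂.eval z * ρ z ^ 2 + q₁.eval z * ρ z + c * q₂.eval z = 0 := by
    intro z hz
    obtain ⟨hz0, hzu, -, -⟩ := hgoodz z hz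
    obtain ⟨han, hne, hslit⟩ := hψball z⁻¹ hzu
    have hroot := hψroot z⁻¹ hzu (inv_ne_zero hz0)
    rw [inv_inv, ← hPQ, hP] at hroot
    exact ⟨han.comp (analyticAt_inv hz0), hne, hslit, hroot⟩
  set S : ℂ → ℂ := fun z => 2 * q₂.eval z * ρ z + q₁.eval z with hS
  have hρan₀ : AnalyticAt ℂ ρ z₀ := (hρfacts z₀ hz₀).1
  have hSan : AnalyticAt ℂ S z₀ :=
    ((analyticAt_const.mul (analyticAt_polynomial_eval q₂ z₀)).mul hρan₀).add
      (analyticAt_polynomial_eval q₁ z₀)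
  have hS2pt : ∀ z : ℂ, R < ‖z‖ → S z ^ 2 = D.eval z := by
    intro z hz
    obtain ⟨-, -, -, hfib⟩ := hρfacts z hz
    simp only [hS, hD, Polynomial.eval_sub, Polynomial.eval_mul, Polynomial.eval_pow, Polynomial.eval_C]
    linear_combination (4 * q₂.eval z) * hfib
  have hS2 : ∀ᶠ z in 𝓝 z₀, S z ^ 2 = D.eval z := by
    filter_upwards [hnear] with z hz using hS2pt z hz
  have hE0 : (q₂ * D).eval z₀ ≠ 0 := by
    obtain ⟨-, -, hq, hd'⟩ := hgoodz z₀ hz₀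
    rw [Polynomial.eval_mul]; exact mul_ne_zero hq hd'
  -- the derivative of `L = log(ρ/θ)` is `W S/(q₂ D)`
  have hL : ∀ᶠ z in 𝓝 z₀, HasDerivAt (fun y => Complex.log (ψ y⁻¹ / θ))
      (W.eval z * S z / (q₂.eval z * D.eval z)) z := by
    have hnear2 := eventually_eventually_nhds.2 hnear
    filter_upwards [hnear, hnear2] with z hz hzz
    obtain ⟨han, hne, hslit, hfib⟩ := hρfacts z hz
    obtain ⟨-, -, hq, hd'⟩ := hgoodz z hz
    have hρd : HasDerivAt ρ (deriv ρ z) z := han.differentiableAt.hasDerivAt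
    -- the differentiated fibre equation
    have hFder : HasDerivAt (fun y => q₂.eval y * ρ y ^ 2 + q₁.eval y * ρ y + c * q₂.eval y)
        ((Polynomial.derivative q₂).eval z * ρ z ^ 2 + q₂.eval z * (((2 : ℕ) : ℂ) * ρ z ^ (2 - 1) * deriv ρ z) +
          ((Polynomial.derivative q₁).eval z * ρ z + q₁.eval z * deriv ρ z) +
          c * (Polynomial.derivative q₂).eval z) z :=
      (((Polynomial.hasDerivAt q₂ z).mul (hρd.pow 2)).add ((Polynomial.hasDerivAt q₁ z).mul hρd)).add
        ((Polynomial.hasDerivAt q₂ z).const_mul c)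
    have hF0 : (fun y => q₂.eval y * ρ y ^ 2 + q₁.eval y * ρ y + c * q₂.eval y) =ᶠ[𝓝 z] fun _ => (0 : ℂ) := by
      filter_upwards [hzz] with y hy using (hρfacts y hy).2.2.2
    have hder0 := hFder.unique ((hasDerivAt_const z (0 : ℂ)).congr_of_eventuallyEq hF0)
    -- `log(ρ/θ)' = ρ'/ρ = W S/(q₂ D)`
    have hlog := (hρd.div_const θ).clog hslit
    refine hlog.congr_deriv ?_
    have hSz : S z ^ 2 = D.eval z := hS2pt z hz
    have hSne : S z ≠ 0 := by
      intro h; rw [h, zero_pow two_ne_zero] at hSz; exact hd' hSz.symm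
    rw [div_div_div_cancel_right₀ hθ0, div_eq_div_iff hne (mul_ne_zero hq hd')]
    have e2 : S z * deriv ρ z + ((Polynomial.derivative q₂).eval z * ρ z ^ 2 +
        (Polynomial.derivative q₁).eval z * ρ z + c * (Polynomial.derivative q₂).eval z) = 0 := by
      rw [hS]; simp only at hder0 ⊢; push_cast at hder0; linear_combination hder0
    have hWz : W.eval z = q₁.eval z * (Polynomial.derivative q₂).eval z -
        q₂.eval z * (Polynomial.derivative q₁).eval z := by
      rw [hW, Polynomial.eval_sub, Polynomial.eval_mul, Polynomial.eval_mul]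
    rw [hWz]
    linear_combination (-(deriv ρ z) * q₂.eval z) * hSz + (q₂.eval z * S z) * e2 +
      (-(S z) * (Polynomial.derivative q₂).eval z) * hfib
  exact not_algebraic_log_quadraticBranch q₁ q₂ D W c hD hW hq₂ ha hq₁a hDodd hSan hLan hS2 hE0
    hL hH0 hH

/-- **ALL quadratic fibres with simple full top row over polynomial graphs of degree `≥ 2` are dense —
up to the discriminant condition in the reciprocal case.**  `P = q₂(x₀)y₀² + q₁(x₀)y₀ + q₀(x₀)`
irreducible with rows of degree `≤ N`, `N ≥ 1`, top row `T = [x₀^N]q₂ X² + [x₀^N]q₁ X + [x₀^N]q₀`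
separable with `[x₀^N]q₂ ≠ 0 ≠ [x₀^N]q₀`; if `q₀ = c·q₂` we ask for a root of odd multiplicity of
`q₁² - 4c q₂²` (e.g. a simple root).  Then `{x₁ = p(x₀), P = 0}` has Zariski-dense exponential points:
THEOREM EB (file XXIX) when `q₀/q₂` is non-constant, the reciprocal theorem above otherwise.
[cite: MantovaMasser2023, §1 Further remarks, p. 5 (the question, open in general)] (new) -/
theorem unprojectedDense_graph_quadraticFibre (q₀ q₁ q₂ : Polynomial ℂ) {P : MvPolynomial (Fin 2) ℂ}
    (hP : ∀ x y : ℂ, MvPolynomial.eval ![x, y] P = q₂.eval x * y ^ 2 + q₁.eval x * y + q₀.eval x)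
    (hirr : Irreducible P) (N : ℕ) (hN1 : 1 ≤ N) (hN₂ : q₂.natDegree ≤ N) (hN₁ : q₁.natDegree ≤ N)
    (hN₀ : q₀.natDegree ≤ N) (ht₂ : q₂.coeff N ≠ 0) (ht₀ : q₀.coeff N ≠ 0)
    (hTsep : (Polynomial.C (q₂.coeff N) * Polynomial.X ^ 2 + Polynomial.C (q₁.coeff N) * Polynomial.X +
      Polynomial.C (q₀.coeff N)).Separable)
    (hdisc : ∀ c : ℂ, q₀ = Polynomial.C c * q₂ →
      ∃ e : ℂ, Odd (Polynomial.rootMultiplicity e (q₁ ^ 2 - Polynomial.C (4 * c) * q₂ ^ 2)))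
    (p : Polynomial ℂ) (hd : 2 ≤ p.natDegree) :
    UnprojectedDense {w : Fin 2 ⊕ Fin 2 → ℂ | w (Sum.inl 1) = p.eval (w (Sum.inl 0)) ∧
      MvPolynomial.eval ![w (Sum.inl 0), w (Sum.inr 0)] P = 0} := by
  classical
  set T : Polynomial ℂ := Polynomial.C (q₂.coeff N) * Polynomial.X ^ 2 + Polynomial.C (q₁.coeff N) * Polynomial.X +
    Polynomial.C (q₀.coeff N) with hTdef
  have hTdeg : T.natDegree = 2 := by rw [hTdef]; exact Polynomial.natDegree_quadratic ht₂
  have hT0 : T ≠ 0 := by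
    intro h; rw [h, Polynomial.natDegree_zero] at hTdeg; exact two_ne_zero hTdeg.symm
  have hT00 : T.eval 0 ≠ 0 := by rw [hTdef]; simpa using ht₀
  have hq₂ : q₂ ≠ 0 := fun h => ht₂ (by rw [h, Polynomial.coeff_zero])
  -- the rows as `Q ∈ ℂ[s][t]`
  set Q : Polynomial (Polynomial ℂ) := Polynomial.C q₂ * Polynomial.X ^ 2 + Polynomial.C q₁ * Polynomial.X +
    Polynomial.C q₀ with hQ
  have hPQ : ∀ x y : ℂ, MvPolynomial.eval ![x, y] P = (Q.map (Polynomial.evalRingHom x)).eval y := by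
    intro x y
    rw [hP, hQ]
    simp only [Polynomial.map_add, Polynomial.map_mul, Polynomial.map_C, Polynomial.map_pow,
      Polynomial.map_X, Polynomial.coe_evalRingHom, Polynomial.eval_add, Polynomial.eval_mul,
      Polynomial.eval_C, Polynomial.eval_pow, Polynomial.eval_X]
  have hcoefQ : ∀ j, Q.coeff j = if j = 2 then q₂ else if j = 1 then q₁ else if j = 0 then q₀ else 0 := by
    intro j
    simp only [hQ, Polynomial.coeff_add, Polynomial.coeff_C_mul, Polynomial.coeff_X_pow, Polynomial.coeff_X,
      Polynomial.coeff_C]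
    rcases j with _ | _ | _ | j <;> simp
  have hQdeg : Q.natDegree = 2 := by rw [hQ]; exact Polynomial.natDegree_quadratic hq₂
  by_cases hrec : ∃ c : ℂ, q₀ = Polynomial.C c * q₂
  · -- reciprocal type
    obtain ⟨c, hc⟩ := hrec
    obtain ⟨e, he⟩ := hdisc c hc
    have hP' : ∀ x y : ℂ, MvPolynomial.eval ![x, y] P = q₂.eval x * y ^ 2 + q₁.eval x * y + c * q₂.eval x := by
      intro x y; rw [hP, hc, Polynomial.eval_mul, Polynomial.eval_C]
    have hcN : q₀.coeff N = c * q₂.coeff N := by rw [hc, Polynomial.coeff_C_mul]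
    -- a simple nonzero root of `T`
    obtain ⟨θ, hθ⟩ : ∃ θ, T.IsRoot θ := Complex.exists_root (by
      rw [Polynomial.degree_eq_natDegree hT0, hTdeg]; norm_num)
    have hθ0 : θ ≠ 0 := by rintro rfl; exact hT00 hθ.eq_zero
    have hT'θ : (Polynomial.derivative T).eval θ ≠ 0 := by
      intro hd0
      obtain ⟨u, v, huv⟩ := (Polynomial.separable_def T).1 hTsep
      have := congrArg (Polynomial.eval θ) huv
      rw [Polynomial.eval_add, Polynomial.eval_mul, Polynomial.eval_mul, hθ.eq_zero, hd0, mul_zero, mul_zero,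
        add_zero, Polynomial.eval_one] at this
      exact zero_ne_one this
    -- a root of `q₂`
    have hq₂deg : 0 < q₂.degree := by
      have : q₂.natDegree = N := le_antisymm hN₂ (Polynomial.le_natDegree_of_ne_zero ht₂)
      rw [Polynomial.degree_eq_natDegree hq₂, this]; exact_mod_cast hN1
    obtain ⟨a, ha⟩ := Complex.exists_root hq₂deg
    exact unprojectedDense_graph_reciprocalQuadratic q₁ q₂ c hP' hirr N hN₂ hN₁ T (by rw [hTdef, hcN]) hT0
      hθ0 hθ hT'θ hq₂ ha he p hd
  · -- non-constant ratio: THEOREM EB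
    have hratio : ∀ c : ℂ, Q.coeff 0 ≠ Polynomial.C c * Q.coeff Q.natDegree := by
      intro c h
      rw [hQdeg, hcoefQ, hcoefQ] at h
      simp only [if_true, show (0 : ℕ) ≠ 2 from by norm_num, show (0 : ℕ) ≠ 1 from by norm_num,
        if_false] at h
      exact hrec ⟨c, h⟩
    refine unprojectedDense_graph_simpleTopRow Q hPQ hirr N (fun j => ?_) T (fun j => ?_) (by rw [hTdeg, hQdeg])
      hTsep hT00 hratio p hd
    · rw [hcoefQ]; split_ifs <;> first | assumption | simp
    · rw [hcoefQ, hTdef]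
      simp only [Polynomial.coeff_add, Polynomial.coeff_C_mul, Polynomial.coeff_X_pow, Polynomial.coeff_X,
        Polynomial.coeff_C]
      rcases j with _ | _ | _ | j <;> simp

end Summit.Schanuel.Schanuel.Theorems
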